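import Literature.Analysis.FluidPDE.ElgindiAprioriBlowupProofs
import Literature.Analysis.FluidPDE.EulerDecayUniqueness
import Literature.Analysis.FluidPDE.EulerTimeDerivDecay
import HarnessLib

/-!
# Uniqueness of `C^{1,γ}` Euler flows on `ℝ³` from the Biot–Savart representation and the
boundedness of the vorticity supports

Topic `Literature/Analysis/FluidPDE` (all results proved, no definitions). Assembly **(E)** of the
decomposition of the named fact
`Literature.Analysis.FluidPDE.MajdaBertozzi2002_holderEulerUniqueness`
(`ElgindiAprioriBlowupProofs.lean`; Majda–Bertozzi, *Vorticity and Incompressible Flow*, §3.1.1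
Cor. 3.1 in the Hölder class `IsHolderEulerSolution γ [0,T) u₀` of Thm 4.2 / Prop. 4.4):

* `holderEulerUniqueness_of_biotSavart_of_support :
    biotSavart_curl_eq_self → (B) → MajdaBertozzi2002_holderEulerUniqueness`,

where (A) `biotSavart_curl_eq_self` (`Vorticity.lean`) is Majda–Bertozzi's Prop. 2.16 (a `C¹`
divergence-free field vanishing at infinity with bounded integrable curl is the Biot–Savart
velocity of its curl) and (B) is the statement that for every solution of the class the supports
of the vorticity slices stay in a fixed ball on every compact time interval `[0, T'] ⊂ [0, T)`
(Majda–Bertozzi Prop. 1.8, (1.51)–(1.52): `supp ω(·,t) = X(·,t)(supp ω₀)`; §4.3 p. 138 of the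
held text: "the support of the vorticity is convected along particle paths"), written out as an
explicit hypothesis (no new definition; it is to be proved in a sibling file). The other two
bricks are proved: (C) `IsClassicalEulerOnDomain.exists_norm_timeDerivWithin_le`
(`EulerTimeDerivDecay.lean`) and (D) `IsClassicalEulerOnDomain.eq_of_decay`
(`EulerDecayUniqueness.lean`).

Proof of the assembly: restrict both solutions to `[0, T)`, `T = min(T₁, T₂)`, pick
`t < T' < T`; on `[0, T']` the slices have `|u|, |∇u| ≤ K` (locally uniform `C^{1,γ}` bounds,
`IsHolderEulerSolution.exists_bound_Icc`) and finite energy, hence tend to `0` at infinity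
(`tendsto_cocompact_of_eEnergy_lt_top`: a finite-energy Lipschitz field vanishes at infinity),
so (A) gives `uᵢ(s) = K₃ ∗ curl uᵢ(s)`; with the uniform support radius of (B),
`|uᵢ(s, x)| ≲ (1 + |x|)⁻²` (`norm_biotSavart_le_bracket`, Majda–Bertozzi Lemma 4.5) and
`|∂ₜuᵢ(s, x)| ≲ (1 + |x|)⁻²` (C); then (D) on `[0, T')` gives `u₁(t) = u₂(t)`.

Also proved here: `norm_apply_le_of_eContDiffHolderNorm_le`,
`norm_fderiv_apply_le_of_eContDiffHolderNorm_le` (pointwise bounds from the `C^{k,r}` norm).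

## References

* A. J. Majda, A. L. Bertozzi, *Vorticity and Incompressible Flow* (CUP 2002), §3.1.1 Cor. 3.1
  (held text p. 78), §2.4.1 Prop. 2.16 (p. 63–64), Prop. 1.8 (p. 25), §4.1.3 Lemma 4.5
  (p. 129), §4.3 p. 138. [MajdaBertozziCUP2002]
-/

noncomputable section

open MeasureTheory Set Function Filter Topology InnerProductSpace Metric
open scoped RealInnerProductSpace ENNReal NNReal

namespace Literature.Analysis.FluidPDE

/-! ### Finite energy and a Lipschitz bound force decay at infinity -/

section DecayAtInfinity

variable {E : Type*} [NormedAddCommGroup E] [InnerProductSpace ℝ E] [FiniteDimensional ℝ E]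
  [MeasurableSpace E] [BorelSpace E]
variable {F : Type*} [NormedAddCommGroup F]

/-- **A finite-energy Lipschitz field tends to zero at infinity.** If `v : E → F` satisfies
`‖v x − v y‖ ≤ L‖x − y‖` and `∫ ‖v‖² < ∞`, then `v(x) → 0` as `|x| → ∞`: were `‖v(x)‖ ≥ ε` at
points `x` escaping to infinity, `‖v‖ ≥ ε/2` on the balls `B(x, r)`, `r = ε/(2L + 2)`, whose
energies `≥ (ε/2)² |B_r|` would not be summable against the tail of `∫ ‖v‖²`. This supplies the
hypothesis "`u → 0` at infinity" of the Biot–Savart representation `biotSavart_curl_eq_self` for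
the slices of the Hölder class (finite energy, bounded gradient). [folklore] -/
theorem tendsto_cocompact_of_eEnergy_lt_top [Nontrivial E] {v : E → F} (hv : Continuous v)
    {L : ℝ} (hL : ∀ x y, ‖v x - v y‖ ≤ L * ‖x - y‖) (hE : eEnergy v < ⊤) :
    Tendsto v (cocompact E) (𝓝 0) := by
  -- the energy density is integrable
  set g : E → ℝ := fun y => ‖v y‖ ^ 2 with hg
  have hgi : Integrable g := by
    refine ⟨(hv.norm.pow 2).aestronglyMeasurable, ?_⟩
    have e : ∀ y, ‖g y‖ₑ = ‖v y‖ₑ ^ 2 := fun y => by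
      rw [hg]
      dsimp only
      rw [Real.enorm_eq_ofReal (sq_nonneg _), ← ofReal_norm, ENNReal.ofReal_pow (norm_nonneg _)]
    show ∫⁻ y, ‖g y‖ₑ < ⊤
    simp_rw [e]
    exact hE
  have hL0 : 0 ≤ L := by
    rcases exists_pair_ne E with ⟨x, y, hxy⟩
    have h := hL x y
    have hpos : 0 < ‖x - y‖ := norm_pos_iff.2 (sub_ne_zero.2 hxy)
    nlinarith [norm_nonneg (v x - v y)]
  rw [Metric.tendsto_nhds]
  intro ε hε
  -- the radius on which `‖v‖ ≥ ε/2` around a point where `‖v‖ ≥ ε`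
  set r : ℝ := ε / (2 * L + 2) with hr
  have hr0 : 0 < r := by positivity
  have hLr : L * r ≤ ε / 2 := by
    rw [hr, mul_div_assoc']
    rw [div_le_div_iff₀ (by positivity) (by positivity)]
    nlinarith
  -- the energy threshold
  set δ : ℝ := (volume (ball (0 : E) r)).toReal * (ε / 2) ^ 2 with hδ
  have hvol : 0 < (volume (ball (0 : E) r)).toReal :=
    ENNReal.toReal_pos (measure_ball_pos volume (0 : E) hr0).ne' measure_ball_lt_top.ne
  have hδ0 : 0 < δ := by positivity
  -- the tails of the energy tend to zero
  set s : ℕ → Set E := fun n => (closedBall (0 : E) n)ᶜ with hs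
  have hsm : ∀ n, MeasurableSet (s n) := fun n => measurableSet_closedBall.compl
  have hanti : Antitone s := fun m n hmn => compl_subset_compl.2
    (closedBall_subset_closedBall (by exact_mod_cast hmn))
  have hinter : (⋂ n, s n) = ∅ := by
    rw [hs]
    simp only [← compl_iUnion, iUnion_closedBall_nat, compl_univ]
  have htail : Tendsto (fun n => ∫ y in s n, g y) atTop (𝓝 0) := by
    have h := tendsto_setIntegral_of_antitone (μ := (volume : Measure E)) (f := g) hsm hanti
      ⟨0, hgi.integrableOn⟩
    rwa [hinter, Measure.restrict_empty, integral_zero_measure] at h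
  obtain ⟨N, hN⟩ := (htail.eventually (gt_mem_nhds hδ0)).exists_forall_of_atTop
  -- beyond radius `N + r`, `‖v‖ < ε`
  have hmem : (closedBall (0 : E) (N + r))ᶜ ∈ cocompact E :=
    mem_cocompact.2 ⟨closedBall 0 (N + r), isCompact_closedBall _ _, Subset.rfl⟩
  filter_upwards [hmem] with x hx
  rw [mem_compl_iff, mem_closedBall_zero_iff, not_le] at hx
  rw [dist_zero_right]
  by_contra hvx
  rw [not_lt] at hvx
  -- on `ball x r`, `‖v‖ ≥ ε/2`
  have hball : ∀ y ∈ ball x r, (ε / 2) ^ 2 ≤ g y := by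
    intro y hy
    rw [mem_ball, dist_eq_norm] at hy
    have h1 : ‖v x‖ - ‖v y‖ ≤ L * r := by
      calc ‖v x‖ - ‖v y‖ ≤ ‖v x - v y‖ := norm_sub_norm_le _ _
        _ ≤ L * ‖x - y‖ := hL x y
        _ ≤ L * r := by
            refine mul_le_mul_of_nonneg_left ?_ hL0
            rw [← norm_neg, neg_sub]; exact hy.le
    have h2 : ε / 2 ≤ ‖v y‖ := by linarith
    exact pow_le_pow_left₀ (by positivity) h2 2
  -- `ball x r ⊆ s N`
  have hsub : ball x r ⊆ s N := by
    intro y hy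
    rw [mem_ball, dist_eq_norm] at hy
    simp only [hs, mem_compl_iff, mem_closedBall_zero_iff, not_le]
    have : ‖x‖ - ‖y‖ ≤ ‖y - x‖ := by
      rw [← norm_neg (y - x), neg_sub]; exact norm_sub_norm_le _ _
    linarith
  have hlow : δ ≤ ∫ y in ball x r, g y := by
    have h := setIntegral_ge_of_const_le (μ := (volume : Measure E)) measurableSet_ball
      measure_ball_lt_top.ne hball (hgi.integrableOn)
    rw [Measure.real, Measure.addHaar_ball_center volume x r, smul_eq_mul] at h
    rwa [hδ]
  have hmono : ∫ y in ball x r, g y ≤ ∫ y in s N, g y :=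
    setIntegral_mono_set hgi.integrableOn (Eventually.of_forall fun y => sq_nonneg _)
      (Eventually.of_forall hsub)
  linarith [hN N le_rfl]

end DecayAtInfinity

/-! ### Pointwise bounds from the `C^{1,γ}` norm -/

section HolderBounds

variable {E' Y : Type*} [NormedAddCommGroup E'] [NormedSpace ℝ E'] [NormedAddCommGroup Y]
  [NormedSpace ℝ Y]

/-- `‖f x‖ ≤ C` when `‖f‖_{C^{k,r}} ≤ C` (the `j = 0` summand of the norm). [folklore] -/
theorem norm_apply_le_of_eContDiffHolderNorm_le {k : ℕ} {r C : ℝ≥0} {f : E' → Y}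
    (hC : FunctionSpaces.eContDiffHolderNorm k r f ≤ C) (x : E') : ‖f x‖ ≤ C := by
  have h1 := FunctionSpaces.enorm_le_eSupNorm (iteratedFDeriv ℝ 0 f) x
  rw [← ofReal_norm, norm_iteratedFDeriv_zero, ofReal_norm] at h1
  have h2 := h1.trans ((eSupNorm_iteratedFDeriv_le_eContDiffHolderNorm (Nat.zero_le k) r f).trans hC)
  exact_mod_cast enorm_le_coe.1 h2

/-- `‖Df x‖ ≤ C` when `‖f‖_{C^{k,r}} ≤ C`, `k ≥ 1` (the `j = 1` summand of the norm). [folklore] -/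
theorem norm_fderiv_apply_le_of_eContDiffHolderNorm_le {k : ℕ} (hk : 1 ≤ k) {r C : ℝ≥0}
    {f : E' → Y} (hC : FunctionSpaces.eContDiffHolderNorm k r f ≤ C) (x : E') :
    ‖fderiv ℝ f x‖ ≤ C := by
  have h1 := FunctionSpaces.enorm_le_eSupNorm (iteratedFDeriv ℝ 1 f) x
  rw [← ofReal_norm, norm_iteratedFDeriv_one, ofReal_norm] at h1
  have h2 := h1.trans ((eSupNorm_iteratedFDeriv_le_eContDiffHolderNorm hk r f).trans hC)
  exact_mod_cast enorm_le_coe.1 h2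

end HolderBounds

/-! ### Uniqueness in the Hölder class from the Biot–Savart representation and the boundedness
of the vorticity supports -/

section Assembly

/-- **Slices of the Hölder class on a compact time interval**: uniform bounds `|u|, |∇u| ≤ K`
(from the locally uniform `C^{1,γ}` bounds) and the Lipschitz bound `‖u(t,x) − u(t,y)‖ ≤ K‖x − y‖`
(mean value theorem). [folklore] -/
theorem IsHolderEulerSolution.exists_bound_Icc {γ : ℝ≥0} {T T' : ℝ} (hT' : T' < T)
    {u₀ : EuclideanSpace ℝ (Fin 3) → EuclideanSpace ℝ (Fin 3)}
    {u : ℝ → EuclideanSpace ℝ (Fin 3) → EuclideanSpace ℝ (Fin 3)}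
    {p : ℝ → EuclideanSpace ℝ (Fin 3) → ℝ} (h : IsHolderEulerSolution γ (Ico 0 T) u₀ u p) :
    ∃ K : ℝ, 0 ≤ K ∧ ∀ t ∈ Icc 0 T', (∀ x, ‖u t x‖ ≤ K ∧ ‖fderiv ℝ (u t) x‖ ≤ K) ∧
      ∀ x y, ‖u t x - u t y‖ ≤ K * ‖x - y‖ := by
  obtain ⟨K, hK⟩ := h.locallyBounded T' (Icc_subset_Ico_right hT')
  refine ⟨K, K.2, fun t ht => ?_⟩
  have hb : ∀ x, ‖u t x‖ ≤ K ∧ ‖fderiv ℝ (u t) x‖ ≤ K := fun x =>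
    ⟨norm_apply_le_of_eContDiffHolderNorm_le (hK t ht) x,
      norm_fderiv_apply_le_of_eContDiffHolderNorm_le le_rfl (hK t ht) x⟩
  refine ⟨hb, fun x y => ?_⟩
  have hdiff : Differentiable ℝ (u t) :=
    (h.slice t (Icc_subset_Ico_right hT' ht)).1.contDiff.differentiable one_ne_zero
  have key := convex_univ.norm_image_sub_le_of_norm_fderiv_le (𝕜 := ℝ) (f := u t)
    (fun z _ => hdiff z) (fun z _ => (hb z).2) (mem_univ y) (mem_univ x)
  exact key

/-- **Uniqueness in the Hölder class from bricks (A) and (B).** Assume (A) the Biot–Savart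
representation `biotSavart_curl_eq_self` (Majda–Bertozzi Prop. 2.16: a `C¹` divergence-free
field vanishing at infinity with bounded integrable curl is `K₃ ∗ curl u`) and (B) that the
vorticity supports of every solution of the Hölder class stay in a bounded set on compact time
intervals (Majda–Bertozzi Prop. 1.8, (1.51)–(1.52) and §4.3 p. 138: "the support of the
vorticity is convected along particle paths"). Then two solutions `IsHolderEulerSolution γ [0,Tᵢ) u₀`
agree on `[0, min(T₁, T₂))` — `MajdaBertozzi2002_holderEulerUniqueness`. Proof: on `[0, T']`,
`t < T' < min(T₁,T₂)`, the slices are bounded with bounded gradient (`exists_bound_Icc`), have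
finite energy, hence tend to `0` at infinity (`tendsto_cocompact_of_eEnergy_lt_top`), so by (A)
`uᵢ(s) = K₃ ∗ curl uᵢ(s)`, whence `|uᵢ| ≲ (1+|x|)⁻²` (`norm_biotSavart_le_bracket`, with the
uniform support radius of (B)) and `|∂ₜuᵢ| ≲ (1+|x|)⁻²` (brick (C),
`IsClassicalEulerOnDomain.exists_norm_timeDerivWithin_le`); brick (D),
`IsClassicalEulerOnDomain.eq_of_decay` (Majda–Bertozzi Cor. 3.1), concludes. [cite: MajdaBertozziCUP2002, §3.1.1 Cor. 3.1 (p. 78 of the held text) with Prop. 2.16 (p. 63–64) and §4.3 p. 138] -/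
theorem holderEulerUniqueness_of_biotSavart_of_support (hA : biotSavart_curl_eq_self)
    (hB : ∀ (γ : ℝ≥0) (u₀ : EuclideanSpace ℝ (Fin 3) → EuclideanSpace ℝ (Fin 3)) (T : ℝ)
      (u : ℝ → EuclideanSpace ℝ (Fin 3) → EuclideanSpace ℝ (Fin 3))
      (p : ℝ → EuclideanSpace ℝ (Fin 3) → ℝ), IsHolderEulerSolution γ (Ico 0 T) u₀ u p →
      ∀ T' : ℝ, T' < T → ∃ R : ℝ, ∀ t ∈ Icc 0 T',
        support (curl (u t)) ⊆ closedBall (0 : EuclideanSpace ℝ (Fin 3)) R) :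
    MajdaBertozzi2002_holderEulerUniqueness := by
  intro γ hγ hγ1 u₀ T₁ T₂ u₁ u₂ p₁ p₂ h₁ h₂ t ht
  -- restrict both solutions to `[0, T)`, `T = min T₁ T₂`, and choose `t < T' < T`
  set T : ℝ := min T₁ T₂ with hT
  have h₁' : IsHolderEulerSolution γ (Ico 0 T) u₀ u₁ p₁ :=
    h₁.restrict (Ico_subset_Ico_right (min_le_left _ _))
  have h₂' : IsHolderEulerSolution γ (Ico 0 T) u₀ u₂ p₂ :=
    h₂.restrict (Ico_subset_Ico_right (min_le_right _ _))
  set T' : ℝ := (t + T) / 2 with hT'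
  have htT' : t < T' := by rw [hT']; linarith [ht.2]
  have hT'T : T' < T := by rw [hT']; linarith [ht.2]
  have hT'0 : 0 < T' := ht.1.trans_lt htT'
  have hIS : Icc 0 T' ⊆ Ico 0 T := Icc_subset_Ico_right hT'T
  -- uniform bounds on `[0, T']`
  obtain ⟨K₁, hK₁0, hK₁⟩ := h₁'.exists_bound_Icc hT'T
  obtain ⟨K₂, hK₂0, hK₂⟩ := h₂'.exists_bound_Icc hT'T
  -- uniform support radius on `[0, T']`
  obtain ⟨R₁, hR₁⟩ := hB γ u₀ T u₁ p₁ h₁' T' hT'T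
  obtain ⟨R₂, hR₂⟩ := hB γ u₀ T u₂ p₂ h₂' T' hT'T
  set R : ℝ := max (max R₁ R₂) 1 with hR
  have hR0 : 0 < R := one_pos.trans_le (le_max_right _ _)
  have hsupp₁ : ∀ s ∈ Icc 0 T', support (curl (u₁ s)) ⊆ closedBall (0 : EuclideanSpace ℝ (Fin 3)) R :=
    fun s hs => (hR₁ s hs).trans (closedBall_subset_closedBall
      ((le_max_left _ _).trans (le_max_left _ _)))
  have hsupp₂ : ∀ s ∈ Icc 0 T', support (curl (u₂ s)) ⊆ closedBall (0 : EuclideanSpace ℝ (Fin 3)) R :=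
    fun s hs => (hR₂ s hs).trans (closedBall_subset_closedBall
      ((le_max_right _ _).trans (le_max_left _ _)))
  -- the Biot–Savart representation of the slices (brick (A))
  have hrep : ∀ {u : ℝ → EuclideanSpace ℝ (Fin 3) → EuclideanSpace ℝ (Fin 3)}
      {p : ℝ → EuclideanSpace ℝ (Fin 3) → ℝ} (h : IsHolderEulerSolution γ (Ico 0 T) u₀ u p)
      {K : ℝ} (hK : ∀ t ∈ Icc 0 T', (∀ x, ‖u t x‖ ≤ K ∧ ‖fderiv ℝ (u t) x‖ ≤ K) ∧
        ∀ x y, ‖u t x - u t y‖ ≤ K * ‖x - y‖),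
      ∀ s ∈ Icc 0 T', biotSavart (curl (u s)) = u s := by
    intro u p h K hK s hs
    have hsS : s ∈ Ico 0 T := hIS hs
    obtain ⟨hhold, hener, hcs⟩ := h.slice s hsS
    have hu1 : ContDiff ℝ 1 (u s) := hhold.contDiff
    have hdiv : VectorCalculus.IsDivFree (u s) := fun x =>
      h.euler.divFree s hsS x (TopologicalSpace.Opens.mem_top x)
    have hωc : Continuous (curl (u s)) := continuous_curl hu1
    have hdecay : Tendsto (u s) (cocompact (EuclideanSpace ℝ (Fin 3))) (𝓝 0) :=
      tendsto_cocompact_of_eEnergy_lt_top hu1.continuous (hK s hs).2 hener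
    obtain ⟨C, hC⟩ := hωc.bounded_above_of_compact_support hcs
    exact hA (u s) hu1 hdiv hdecay (hωc.integrable_of_hasCompactSupport hcs) ⟨C, hC⟩
  have hrep₁ : ∀ s ∈ Icc 0 T', biotSavart (curl (u₁ s)) = u₁ s := hrep h₁' hK₁
  have hrep₂ : ∀ s ∈ Icc 0 T', biotSavart (curl (u₂ s)) = u₂ s := hrep h₂' hK₂
  -- decay of the velocities: `|uᵢ(s,x)| ≤ Aᵢ (1 + |x|)⁻²`
  have hdecayU : ∀ {u : ℝ → EuclideanSpace ℝ (Fin 3) → EuclideanSpace ℝ (Fin 3)} {K : ℝ},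
      (∀ t ∈ Icc 0 T', (∀ x, ‖u t x‖ ≤ K ∧ ‖fderiv ℝ (u t) x‖ ≤ K) ∧
        ∀ x y, ‖u t x - u t y‖ ≤ K * ‖x - y‖) →
      (∀ s ∈ Icc 0 T', biotSavart (curl (u s)) = u s) →
      (∀ s ∈ Icc 0 T', support (curl (u s)) ⊆ closedBall (0 : EuclideanSpace ℝ (Fin 3)) R) →
      ∃ A : ℝ, ∀ s ∈ Icc 0 T', ∀ x, ‖u s x‖ ≤ A * ((1 + ‖x‖) ^ 2)⁻¹ := by
    intro u K hK hrepu hsuppu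
    set M : ℝ := 4 * K with hM
    refine ⟨max (5 * M * R * (1 + 2 * R) ^ 2) (4 / 3 * M * R ^ 3 * (1 + (2 * R)⁻¹) ^ 2),
      fun s hs x => ?_⟩
    have hMb : ∀ y, ‖curl (u s) y‖ ≤ M := fun y => by
      refine (norm_curl_le_four_mul (u s) y).trans ?_
      rw [hM]
      exact mul_le_mul_of_nonneg_left ((hK s hs).1 y).2 (by norm_num)
    have h := norm_biotSavart_le_bracket (x₀ := 0) hR0 hMb (by simpa using hsuppu s hs) x
    rw [hrepu s hs, sub_zero] at h
    exact h
  obtain ⟨A₁, hA₁⟩ := hdecayU hK₁ hrep₁ hsupp₁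
  obtain ⟨A₂, hA₂⟩ := hdecayU hK₂ hrep₂ hsupp₂
  -- decay of the time derivatives (brick (C))
  obtain ⟨D₁, hD₁⟩ := h₁'.euler.exists_norm_timeDerivWithin_le hT'T hT'0 hrep₁ hsupp₁
    (fun s hs x => (hK₁ s hs).1 x)
  obtain ⟨D₂, hD₂⟩ := h₂'.euler.exists_norm_timeDerivWithin_le hT'T hT'0 hrep₂ hsupp₂
    (fun s hs x => (hK₂ s hs).1 x)
  -- the restrictions to `[0, T')` and the energy method (brick (D))
  have hS' : UniqueDiffOn ℝ (Ico 0 T') := uniqueDiffOn_Ico 0 T'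
  have hsub : Ico 0 T' ⊆ Ico 0 T := Ico_subset_Ico_right hT'T.le
  have e₁ := h₁'.euler.mono hsub hS'
  have e₂ := h₂'.euler.mono hsub hS'
  have hdt : ∀ {u : ℝ → EuclideanSpace ℝ (Fin 3) → EuclideanSpace ℝ (Fin 3)}
      {p : ℝ → EuclideanSpace ℝ (Fin 3) → ℝ} (h : IsHolderEulerSolution γ (Ico 0 T) u₀ u p),
      ∀ s ∈ Ico 0 T', ∀ x, timeDerivWithin (Ico 0 T') u s x = timeDerivWithin (Ico 0 T) u s x := by
    intro u p h s hs x
    exact timeDerivWithin_eq_of_subset_of_contDiffOn h.euler.smooth.1 one_ne_zero hsub hS' hs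
      (subset_closure (TopologicalSpace.Opens.mem_top x))
  set C : ℝ := max (max A₁ A₂) (max D₁ D₂) with hC
  have hw : ∀ x : EuclideanSpace ℝ (Fin 3), 0 ≤ ((1 + ‖x‖) ^ 2)⁻¹ := fun x => by positivity
  have key := IsClassicalEulerOnDomain.eq_of_decay (E := EuclideanSpace ℝ (Fin 3))
    (by rw [finrank_euclideanSpace_fin]; norm_num) (by rw [finrank_euclideanSpace_fin]) e₁ e₂
    (by rw [h₁'.initial, h₂'.initial]) (C := C) (M := max K₁ K₂)
    (fun s hs x => (hA₁ s (Ico_subset_Icc_self hs) x).trans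
      (mul_le_mul_of_nonneg_right ((le_max_left _ _).trans (le_max_left _ _)) (hw x)))
    (fun s hs x => (hA₂ s (Ico_subset_Icc_self hs) x).trans
      (mul_le_mul_of_nonneg_right ((le_max_right _ _).trans (le_max_left _ _)) (hw x)))
    (fun s hs x => ((hK₁ s (Ico_subset_Icc_self hs)).1 x).2.trans (le_max_left _ _))
    (fun s hs x => ((hK₂ s (Ico_subset_Icc_self hs)).1 x).2.trans (le_max_right _ _))
    (fun s hs x => by
      rw [hdt h₁' s hs x]
      exact (hD₁ s (Ico_subset_Icc_self hs) x).trans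
        (mul_le_mul_of_nonneg_right ((le_max_left _ _).trans (le_max_right _ _)) (hw x)))
    (fun s hs x => by
      rw [hdt h₂' s hs x]
      exact (hD₂ s (Ico_subset_Icc_self hs) x).trans
        (mul_le_mul_of_nonneg_right ((le_max_right _ _).trans (le_max_right _ _)) (hw x)))
    (t := t) ⟨ht.1, htT'⟩
  exact key

end Assembly

end Literature.Analysis.FluidPDE
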